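import Summits.Parity.GeneralizedHardyLittlewood.Theses.MaynardProductExact
import Literature.NumberTheory.Sieve.MaynardProductKernelCert3750Lit
import Literature.NumberTheory.Sieve.MaynardProductKernelCert3750Table
import Summits.Parity.GeneralizedHardyLittlewood.Theorems.MaynardProductExactNumLB3749SlicesA
import Summits.Parity.GeneralizedHardyLittlewood.Theorems.MaynardProductExactNumLB3749SlicesB
import Summits.Parity.GeneralizedHardyLittlewood.Theorems.MaynardProductExactNumLB3749Tab

/-! # Route `MaynardProductExact` — crux `NumLB3749` (stmt-Parity-19245) CLOSED by the `k = 3750` kernel certificate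

The registered stub `stub_numHoeffdingCert` of `Cruxes/NumLB3749/Lines/birth.lean` is the assembly
`Literature.NumberTheory.Sieve.MaynardTao.ProductKernelCert3750.stub_of_factsSL` applied to the kernel facts of the helper files
`…NumLB3749Tab` (`okT okCh okFin okQ0 okQ1 okQ2 okS`) and `…NumLB3749SlicesA/B` (`okSl0–okSl7`).  The crux then follows BY NAME through the line's
composition (`NumLB3749_of` of the skeleton, verbatim: one application of `sum_weight_dconvPow_le_setIntegral_cpow_hoeffding` with the antitone
weight `Ψ(w) = (∫_{(0,1−w]} g)²`).  Rung F-P1.R4 bookkeeping; no summit is proved by this file. -/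

noncomputable section

open MeasureTheory Set Finset
open Literature.Analysis.Convolution Literature.NumberTheory.Sieve Literature.NumberTheory.Sieve.MaynardTao
open Literature.NumberTheory.Sieve.MaynardTao.ProductKernelCert3750

namespace Summit.Parity.GeneralizedHardyLittlewood.MaynardProductExactNumLB3749

/-- **The registered stub `stub_numHoeffdingCert`** (signature verbatim) from the kernel facts. -/
theorem stub_numHoeffdingCert :
    ∃ (h : ℝ) (Jc M : ℕ) (δ lam : ℝ), 0 < h ∧ (3 : ℝ) / 4 < (Jc : ℝ) * h ∧ 0 ≤ lam ∧
      δ + lam ≤ (3749 : ℝ) * (h -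
        (∫ x in Ici 0, roundErr h x * polymathProfile 3750 ((249 : ℝ) / 2000) ((3 : ℝ) / 4) x ^ 2) /
          ((1000000 : ℝ) / 466771167)) ∧
      (19076 : ℝ) / 10000000000 * ((1000000 : ℝ) / 466771167) ^ 3749 ≤
        ∑ m ∈ range M,
            (∫ u in Ioc 0 (1 - ((((m + 3749 : ℕ) : ℝ)) * h - δ)),
                polymathProfile 3750 ((249 : ℝ) / 2000) ((3 : ℝ) / 4) u) ^ 2 *
              dconvPow (cellMass (fun t => polymathProfile 3750 ((249 : ℝ) / 2000) ((3 : ℝ) / 4) t ^ 2) h) 3749 m -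
          (∫ u in Ioc 0 ((3 : ℝ) / 4), polymathProfile 3750 ((249 : ℝ) / 2000) ((3 : ℝ) / 4) u) ^ 2 *
            (((1000000 : ℝ) / 466771167) ^ 3749 * Real.exp (-2 * lam ^ 2 / ((3749 : ℝ) * h ^ 2))) :=
  stub_of_factsSL TLIT okT okCh _ _ _ _ _ _ _ _ okSl0 okSl1 okSl2 okSl3 okSl4 okSl5 okSl6 okSl7 okFin _ _ _ _ _ _ okQ0 okQ1 okQ2 okS

/-- **the crux `NumLB3749` BY NAME from the lattice certificate**: the line's composition (`NumLB3749_of` of the skeleton, verbatim: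
one application of `sum_weight_dconvPow_le_setIntegral_cpow_hoeffding` with the antitone weight `Ψ(w) = (∫_{(0,1−w]} g)²`). -/
theorem numLB3749_of_certificate (hstub :
    ∃ (h : ℝ) (Jc M : ℕ) (δ lam : ℝ), 0 < h ∧ (3 : ℝ) / 4 < (Jc : ℝ) * h ∧ 0 ≤ lam ∧
      δ + lam ≤ (3749 : ℝ) * (h -
        (∫ x in Ici 0, roundErr h x * polymathProfile 3750 ((249 : ℝ) / 2000) ((3 : ℝ) / 4) x ^ 2) /
          ((1000000 : ℝ) / 466771167)) ∧
      (19076 : ℝ) / 10000000000 * ((1000000 : ℝ) / 466771167) ^ 3749 ≤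
        ∑ m ∈ range M,
            (∫ u in Ioc 0 (1 - ((((m + 3749 : ℕ) : ℝ)) * h - δ)),
                polymathProfile 3750 ((249 : ℝ) / 2000) ((3 : ℝ) / 4) u) ^ 2 *
              dconvPow (cellMass (fun t => polymathProfile 3750 ((249 : ℝ) / 2000) ((3 : ℝ) / 4) t ^ 2) h) 3749 m -
          (∫ u in Ioc 0 ((3 : ℝ) / 4), polymathProfile 3750 ((249 : ℝ) / 2000) ((3 : ℝ) / 4) u) ^ 2 *
            (((1000000 : ℝ) / 466771167) ^ 3749 * Real.exp (-2 * lam ^ 2 / ((3749 : ℝ) * h ^ 2)))) :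
    Summit.Parity.GeneralizedHardyLittlewood.Theses.MaynardProductExact.NumLB3749 := by
  obtain ⟨h, Jc, M, δ, lam, hh, hJc, hlam, hcond, hsum⟩ := hstub
  have hm₀pos : (0 : ℝ) < (1000000 : ℝ) / 466771167 := by norm_num
  -- the weight `Ψ(w) = (∫_{(0,1−w]} g)²`
  set G : ℝ → ℝ := fun y => ∫ u in Ioc 0 y, g u with hGdef
  set Ψ : ℝ → ℝ := fun w => G (1 - w) ^ 2 with hΨdef
  have hG0 : ∀ y, 0 ≤ G y := fun y => setIntegral_nonneg measurableSet_Ioc fun u _ => g_nonneg u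
  have hGmono : Monotone G := by
    intro a b hab
    exact setIntegral_mono_set (g_locBdd.integrableOn_Ioc _ _)
      (Filter.Eventually.of_forall fun u => g_nonneg u)
      (Filter.Eventually.of_forall (Ioc_subset_Ioc_right hab))
  have hΨ : Antitone Ψ := by
    intro a b hab
    simp only [hΨdef]
    exact pow_le_pow_left₀ (hG0 _) (hGmono (by linarith)) 2
  have hΨ0 : ∀ x, 0 ≤ Ψ x := fun x => sq_nonneg _
  have hΨ1 : Ψ 1 = 0 := by simp [hΨdef, hGdef]
  have hΨB : ∀ x, Ψ x ≤ (∫ u in Ioc 0 ((3 : ℝ) / 4), g u) ^ 2 := fun x =>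
    pow_le_pow_left₀ (hG0 _)
      (setIntegral_Ioc_le_setIntegral_Ioc_of_support g_locBdd g_nonneg g_eq_zero_of_gt (by norm_num) _) 2
  have hcond' : δ + lam ≤
      ((3748 : ℕ) + 1 : ℝ) * (h - (∫ x in Ici 0, roundErr h x * φ x) / ((1000000 : ℝ) / 466771167)) := by
    have e : ((3748 : ℕ) + 1 : ℝ) = (3749 : ℝ) := by norm_num
    rw [e]; exact hcond
  have main := sum_weight_dconvPow_le_setIntegral_cpow_hoeffding φ_locBdd φ_nonneg φ_eq_zero_of_gt hh hJc 3748
    hΨ hΨ0 hΨB hΨ1 M δ hlam mass_eq hm₀pos hcond'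
  have e1 : (3748 + 1 : ℕ) = 3749 := rfl
  have e2 : ((3748 : ℕ) + 1 : ℝ) = (3749 : ℝ) := by norm_num
  have hInt : ∫ w in Ioc 0 1, Ψ w * cpow φ (3748 + 1) w =
      ∫ w in Ioc (0 : ℝ) 1, (∫ u in (0 : ℝ)..(1 - w), polymathProfile 3750 ((249 : ℝ) / 2000) ((3 : ℝ) / 4) u) ^ 2 *
        cpow (fun t => polymathProfile 3750 ((249 : ℝ) / 2000) ((3 : ℝ) / 4) t ^ 2) 3749 w := by
    refine setIntegral_congr_fun measurableSet_Ioc fun w hw => ?_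
    simp only [hΨdef, hGdef, g, e1]
    rw [intervalIntegral.integral_of_le (by linarith [hw.2])]
    rfl
  rw [hInt] at main
  simp only [hΨdef, hGdef, g, e1, e2] at main
  exact hsum.trans main




/-- **`NumLB3749` (item stmt-Parity-19245) holds** — the route decl BY NAME. -/
theorem numLB3749_proof : Summit.Parity.GeneralizedHardyLittlewood.Theses.MaynardProductExact.NumLB3749 :=
  numLB3749_of_certificate stub_numHoeffdingCert

end Summit.Parity.GeneralizedHardyLittlewood.MaynardProductExactNumLB3749

end
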